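import Summits.QuantumFields.YangMills.Theorems.BalabanUVNodesN20QuantisedRatioNoRescue
import Summits.QuantumFields.YangMills.Theorems.BalabanUVNodesSpineReadingOfRecord13CoPHV
import Summits.QuantumFields.YangMills.Theorems.BalabanUVNodesN21KeyedShellWeightShellZero

/-!
# BalabanUVNodes ∕ N20·N19′ — NO DIAL RESCUES THE CORE EDGE, AT dag-n20-d's SPINE READING OF RECORD `crOfRecord₁₃VAt K₀ jcut sh` (physical volume letter): IF the
# record's keyed class weights `weightA₁₃ ∕ weightB₁₃` on `classSet₁₃` carry a D-QUANTISED two-run log-ratio along an integer key label (Q) with an ANTI-CONCENTRATED label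
# (ACn), frequently in `K`, then for EVERY persistence policy `jcut` and EVERY shell split `sh` the three K5 face-bodies of K3⁷ v5 stub 2 at that reading —
# `RelWeightBound` (N20) · `ShellWeightBound` (N21) · `∃ δ, NE7.Core … δ ∧ Summable δ` (N19′) — cannot hold together

Cell `pub-ymgap`, YM-PLAN Track A (HUMAN RULING D-0062; D-0149 ∕ D-0154, director-ym R399 (3a)); width seat `pub-ymgap-dag-n20-w5` (g0) on node N20 = NE7b; key item K3⁷
`SpineGivenEndpointR13SepCoPH` = stmt-QuantumFields-20544 (`--kind proof --supports 20544 --as helper`); COUNT-NEUTRAL.  Companion of `…N20QuantisedRatioNoRescue` (the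
[folklore] mechanism: the binders pay the misfit, quantisation + anti-concentration make it large); bus CLAIM-1 ∕ INTENT-1∕2 (pub-ymgap INBOX l.29068).

WHAT IT SAYS AT THE RECORD.  K3⁷ v5 (941dddb108cbaacf) pins stub 2's spine reading on the live-selector line to `crOfRecord₁₃V (jc F θ hP g₀ os) sh` (`PinnedAtLive`), whose class
set ∕ class weights are dag-n20-d's `classSet₁₃ θ K₀ g₀` ∕ `weightA₁₃ θ hP K₀ g₀ os` ∕ `weightB₁₃ θ hP K₀ g₀ os` (`rfl` dictionary `crOfRecord₁₃VAt_T ∕ _A ∕ _B`) for EVERY cut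
value and EVERY split — the dials `jcut`, `sh` move only `Bad ∕ shA ∕ shB ∕ W ∕ Wsh ∕ δ`.  So ONE application of `not_coreEdge_of_quantised_antiConc` (all dials universal) gives:
at a tuple where (Q) ∧ (ACn) hold frequently at some source `|t| ≤ 1` (`0 ≤ weightA₁₃` being dag-n20-w2's `weightA₁₃_nonneg`, CITED), NO `(jcut, sh)` makes the N20, N21 and
N19′ face-bodies hold together there.  The two rows are DISPLAYED HYPOTHESES and are exactly what the crux card `window-key-core` locates: (Q) with `D ≠ 0` = its (N)∕(XG)
contrast row («per old large-field block the two runs' single-block free-energy contrast differs by `D₀`») — an ANALYTIC property of def-T's step kernels inside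
`Node00.classWeightOfDatum₉ = ∫ χ_k(s)·dressedSlotsOfDatum₉ …` that no identity of the tree and no row of `Provisos₁₃CoPH` (numerics) decides either way; (ACn) = the
first-level-saturation mechanism (dag-n20-w1 `…N20KeyedRelWeightPolicyWall` p597932's displayed antecedent; dag-n20-w3 LOCATED-1, evidence #10: reads «pending» iff
`θ.ppSel` is history-rewriting, dag-n20-d's (ρ1)∕(ρ2) note at `crOfRecord₁₃` :29–:34).  Deciding them at the record is NODE O ∕ cdisprove business; this file books the
consequence so that a decision of (Q) ∧ (ACn) at ONE live guarded tuple carrying the rates is a decision of stub 2 at v5's pin for ALL dials at once.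

CONTENTS.  ★ `not_faces_crOfRecord₁₃VAt_of_quantised_antiConc`.

HONEST FRAMING.  Bookkeeping BY NAME over dag-n20-d's reading and the companion file; (Q) ∕ (ACn) NOT asserted for Bałaban's objects and NOT decided; proves NO estimate;
refutes NO registered stub; nothing of Bałaban's asserted; NE7 ∕ NE7b ∕ NE7c NOT PRINTED for d = 4 ∕ NOT proved; the shell split is NOT inhabited (NODE O); no
`Provisos₁₃CoPH` inhabitant claimed (K0⁷ OPEN); N19 ∕ N20 ∕ N21 NOT discharged; K3⁷ OPEN; counts UNMOVED (typed 28∕28 · discharged 5∕27, A 5∕28); no count claim; no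
summit statement is proved by this seat; one finite 𝕋⁴ programme at fixed ε, Bałaban AS PRINTED — R4 closes the conditional rung `BalabanLadder.UV` only; the YM mass gap
(Clay) is NOT proved by any of this; NOT ℝ⁴, NOT OS.  No `def`, no `instance`, no `notation`, no `sorry`; no decl carries a cite tag.
-/

noncomputable section

open Finset Real
open _root_.Filter _root_.Topology

namespace Summit.QuantumFields.YangMills.BalabanUVNodes.N20QuantisedRatioNoRescueAtRecord

open Literature.MathematicalPhysics.QuantumFieldTheory.Balaban1983to89
open Literature.MathematicalPhysics.QuantumFieldTheory.Balaban1983to89.T4WeightBudget (RelWeightBound)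
open Literature.MathematicalPhysics.QuantumFieldTheory.Balaban1983to89.T4IndicatorShell (ShellWeightBound)
open Summit.QuantumFields.BalabanUV.T4Continuum.Spine.NE7 (Core)
open Summit.QuantumFields.YangMills.BalabanUVNodes.N20QuantisedRatioNoRescue (not_coreEdge_of_quantised_antiConc)

/-! ## §1  At the reading of record: every cut value, every shell split -/

section AtTheReading

open YMDAG.UVSplit
open Literature.MathematicalPhysics.QuantumFieldTheory.Balaban1983to89.T4Continuum
open Literature.MathematicalPhysics.QuantumFieldTheory.Balaban1983to89.Node00
open Summit.QuantumFields.YangMills.BalabanUVNodes.N21KeyedShellWeightShellZero (weightA₁₃_nonneg)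

variable {F : T4Family} {N : ℕ} [NeZero N]

/-- ★ **NO CUT READING VALUE AND NO SHELL SPLIT RESCUE STUB 2's FACES AT THE READING OF RECORD** [folklore]: at a Stage-13 tuple `(F, θ, hP, g₀, os)`, IF frequently in
`K` some source `|t| ≤ 1` has positive total run-A class weight, (Q) the two-run log-ratio `log(weightB₁₃ ∕ weightA₁₃)` D-QUANTISED along an integer label of the σ-packed
keys up to `ε < D∕4`, and (ACn) that label ANTI-CONCENTRATED under `weightA₁₃` (no level above the fraction `m` of the total, `m(1 + e^{3D∕4}) ≤ 1∕2`) — two DISPLAYED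
HYPOTHESES, NOT asserted for Bałaban's objects — then for EVERY persistence policy `jcut` and EVERY shell split `sh` the three K5 face-bodies of K3⁷ v5 stub 2 at
`crOfRecord₁₃VAt K₀ jcut sh F θ hP g₀ os` — `RelWeightBound` (N20), `ShellWeightBound` (N21) and `∃ δ, NE7.Core … δ ∧ Summable δ` (N19′) — do NOT hold together
(`0 ≤ weightA₁₃` is dag-n20-w2's `weightA₁₃_nonneg`, cited).  (Q) with `D ≠ 0` is the crux card's (XG)∕(N) contrast row — an ANALYTIC property of def-T's step kernels inside
`Node00.classWeightOfDatum₉`, NOT decided here; (ACn) is the first-level-saturation mechanism (dag-n20-w1 `…N20KeyedRelWeightPolicyWall`'s displayed antecedent). -/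
theorem not_faces_crOfRecord₁₃VAt_of_quantised_antiConc (K₀ : ℕ) (jcut : ℕ → ℕ) (sh : ShellSplit₁₃CoPH N K₀)
    (θ : Stage13HParams F N) (hP : θ.Provisos₁₃CoPH F N) (g₀ : ℕ → ℝ) (os : List (ULoop F))
    {D ε m : ℝ} (hD : 0 < D) (hεD : ε < D / 4) (hm : 0 ≤ m) (hm2 : m * (1 + exp (3 * D / 4)) ≤ 1 / 2)
    (v : ℕ → ℝ → (Σ K, SiteSeqKey F (K₀ + K)) → ℤ) (c₀ : ℕ → ℝ → ℝ)
    (hfreq : ∃ᶠ K in atTop, ∃ t : ℝ, |t| ≤ 1 ∧ 0 < ∑ x ∈ classSet₁₃ θ K₀ g₀ K, weightA₁₃ θ hP K₀ g₀ os K t x ∧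
      (∀ x ∈ classSet₁₃ θ K₀ g₀ K,
        exp (c₀ K t + D * (v K t x : ℝ) - ε) * weightA₁₃ θ hP K₀ g₀ os K t x ≤ weightB₁₃ θ hP K₀ g₀ os K t x ∧
          weightB₁₃ θ hP K₀ g₀ os K t x ≤ exp (c₀ K t + D * (v K t x : ℝ) + ε) * weightA₁₃ θ hP K₀ g₀ os K t x) ∧
      (∀ n : ℤ, ∑ x ∈ (classSet₁₃ θ K₀ g₀ K).filter (fun x => v K t x = n), weightA₁₃ θ hP K₀ g₀ os K t x ≤
        m * ∑ x ∈ classSet₁₃ θ K₀ g₀ K, weightA₁₃ θ hP K₀ g₀ os K t x)) :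
    letI := (crOfRecord₁₃VAt K₀ jcut sh F θ hP g₀ os).dec
    ¬ (RelWeightBound (crOfRecord₁₃VAt K₀ jcut sh F θ hP g₀ os).l₀ (crOfRecord₁₃VAt K₀ jcut sh F θ hP g₀ os).T (crOfRecord₁₃VAt K₀ jcut sh F θ hP g₀ os).A
          (crOfRecord₁₃VAt K₀ jcut sh F θ hP g₀ os).B (crOfRecord₁₃VAt K₀ jcut sh F θ hP g₀ os).Bad (crOfRecord₁₃VAt K₀ jcut sh F θ hP g₀ os).W ∧
       ShellWeightBound (crOfRecord₁₃VAt K₀ jcut sh F θ hP g₀ os).l₀ (crOfRecord₁₃VAt K₀ jcut sh F θ hP g₀ os).T (crOfRecord₁₃VAt K₀ jcut sh F θ hP g₀ os).A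
          (crOfRecord₁₃VAt K₀ jcut sh F θ hP g₀ os).B (crOfRecord₁₃VAt K₀ jcut sh F θ hP g₀ os).shA (crOfRecord₁₃VAt K₀ jcut sh F θ hP g₀ os).shB
          (crOfRecord₁₃VAt K₀ jcut sh F θ hP g₀ os).Wsh ∧
       ∃ δ : ℕ → ℝ, Core (crOfRecord₁₃VAt K₀ jcut sh F θ hP g₀ os).l₀ (crOfRecord₁₃VAt K₀ jcut sh F θ hP g₀ os).vol (crOfRecord₁₃VAt K₀ jcut sh F θ hP g₀ os).T
          (crOfRecord₁₃VAt K₀ jcut sh F θ hP g₀ os).Bad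
          (fun K t τ => (crOfRecord₁₃VAt K₀ jcut sh F θ hP g₀ os).A K t τ - (crOfRecord₁₃VAt K₀ jcut sh F θ hP g₀ os).shA K t τ)
          (fun K t τ => (crOfRecord₁₃VAt K₀ jcut sh F θ hP g₀ os).B K t τ - (crOfRecord₁₃VAt K₀ jcut sh F θ hP g₀ os).shB K t τ) δ ∧ Summable δ) := by
  letI := (crOfRecord₁₃VAt K₀ jcut sh F θ hP g₀ os).dec
  rintro ⟨hW, hSh, hex⟩
  have hfreq' : ∃ᶠ K in atTop, ∃ t : ℝ, |t| ≤ (crOfRecord₁₃VAt K₀ jcut sh F θ hP g₀ os).l₀ ∧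
      0 < ∑ x ∈ (crOfRecord₁₃VAt K₀ jcut sh F θ hP g₀ os).T K, (crOfRecord₁₃VAt K₀ jcut sh F θ hP g₀ os).A K t x ∧
      (∀ x ∈ (crOfRecord₁₃VAt K₀ jcut sh F θ hP g₀ os).T K, 0 ≤ (crOfRecord₁₃VAt K₀ jcut sh F θ hP g₀ os).A K t x) ∧
      (∀ x ∈ (crOfRecord₁₃VAt K₀ jcut sh F θ hP g₀ os).T K,
        exp (c₀ K t + D * (v K t x : ℝ) - ε) * (crOfRecord₁₃VAt K₀ jcut sh F θ hP g₀ os).A K t x ≤ (crOfRecord₁₃VAt K₀ jcut sh F θ hP g₀ os).B K t x ∧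
          (crOfRecord₁₃VAt K₀ jcut sh F θ hP g₀ os).B K t x ≤ exp (c₀ K t + D * (v K t x : ℝ) + ε) * (crOfRecord₁₃VAt K₀ jcut sh F θ hP g₀ os).A K t x) ∧
      (∀ n : ℤ, ∑ x ∈ ((crOfRecord₁₃VAt K₀ jcut sh F θ hP g₀ os).T K).filter (fun x => v K t x = n), (crOfRecord₁₃VAt K₀ jcut sh F θ hP g₀ os).A K t x ≤
        m * ∑ x ∈ (crOfRecord₁₃VAt K₀ jcut sh F θ hP g₀ os).T K, (crOfRecord₁₃VAt K₀ jcut sh F θ hP g₀ os).A K t x) :=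
    hfreq.mono fun K ⟨t, ht, hpos, hQ, hAC⟩ => ⟨t, ht, hpos, fun x _ => weightA₁₃_nonneg F θ hP K₀ g₀ os K t x, hQ, hAC⟩
  exact not_coreEdge_of_quantised_antiConc hD hεD hm hm2 hfreq' hW hSh hex

end AtTheReading

end Summit.QuantumFields.YangMills.BalabanUVNodes.N20QuantisedRatioNoRescueAtRecord

end
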